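import Summits.BirchSwinnertonDyer.BirchSwinnertonDyer.Theorems.ManinLocalTwoThreeKummerCubeSigmaLeaves
import Summits.BirchSwinnertonDyer.BirchSwinnertonDyer.Theorems.ManinLocalTwoThreeThreeBlindInvariance
import Literature.NumberTheory.EllipticCurves.ModThreeReducibleIffPsi3Root
import HarnessLib

/-!
# (EXISTC) a reducible `E[3]` WITHOUT rational `3`-torsion has a `K`-point of order `3` with RATIONAL abscissa and an analytic lift
(route `ManinLocalTwoThree`, crux C3 `ManinPrimeToThreeAtNine` stmt-BirchSwinnertonDyer-22968; cell bsd-f2-manin, C3 LEAD p1 gen 16;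
`--supports stmt-BirchSwinnertonDyer-22968`; node EXISTC `ReducibleShortThreeTorsionLiftC` of -an g39's K-LINE split of the residual RES₃♭
(HOME/an/g39/UDCKummerLineK-an-g39.lean, MEMO-an §82: RES₃♭ ⟸ EXISTC ∧ GENΣ ∧ KLINE ∧ RESΣ), UNCONDITIONAL, with -an's `IsShortThreeTorsionC` UNFOLDED
(nonsingular affine point of the short model base-changed to `ℂ`, abscissa a root of `Ψ₃`) so that the by-name form is definitional once the statement
file lands)

**`exists_shortThreeTorsionC_lift`.**  For a globally minimal `W`, an `X₀(N)`-datum `D` (`c = D.c`) with `E[3]` REDUCIBLE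
(`¬ W.HasIrreducibleModPGaloisRep 3`) and NO rational point of order `3` on the short model `E_{W,c}`: there are `X₀ ∈ ℚ`, `Y₀ ∈ ℂ ∖ ℚ` and `u ∈ ℂ` with
`(X₀, Y₀)` a nonsingular point of `E_{W,c}/ℂ` whose abscissa is a root of `Ψ₃^{E_{W,c}}`, `u ∉ Λ_E`, `3u ∈ Λ_E`, `c²℘(u) = X₀`, `c³℘'(u)/2 = Y₀`.
Proof.  Reducible `E[3]` ⟹ a RATIONAL root `x₀` of `Ψ₃^W` (tree `WeierstrassCurve.exists_isRoot_Ψ₃_of_not_hasIrreducibleModPGaloisRep_three`, Cremona §3.8 /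
Silverman III.4.12 + Ex. 3.7); `℘_Λ` is onto and `Ψ₃(℘(u) − b₂/12) = 0 ⟺ 3u ∈ Λ` (tree `exists_third_period_of_Ψ₃_root`), giving `u` with
`℘(u) = x₀ + b₂/12`; put `X₀ := c²(x₀ + b₂/12)`, `Y₀ := c³℘'(u)/2`; `Ψ₃^{E_{W,c}}(X₀) = c⁸Ψ₃^W(x₀) = 0`; the short-model equation `Y₀² = X₀³ + a₄X₀ + a₆`
is `℘'² = 4℘³ − g₂℘ − g₃` with `g₂ = c₄/12`, `g₃ = c₆/216` (`isNeronLattice`), and every point of the (nonsingular) short model is nonsingular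
(`equation_iff_nonsingular_of_Δ_ne_zero`, `Δ(E_{W,c}) = c¹²Δ(W)`); finally `Y₀ ∉ ℚ` because a rational `Y₀` would make `(X₀, Y₀)` a rational point of
order `3` (`IsShortThreeTorsion`), excluded by hypothesis.
HONEST FRAMING.  A dictionary lemma; it does NOT prove RES₃♭, C3, Manin's conjecture or BSD (all OPEN).  No definitions, no named facts, no sorry.
[cite: Cremona1997, §3.8 (`l = 3`: one `x`-coordinate, which must be rational)] [cite: SilvermanAEC2009, III.4.12, Exercise 3.7 and VI.5.1 (uniformisation)]
-/

set_option autoImplicit false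
-- lint-debt: the directory name repeats the summit name (sibling precedent `ManinLocalTwoThreeKummerCubeSigmaLeaves.lean`)
set_option linter.dupNamespace false

noncomputable section

open scoped PeriodPair
open WeierstrassCurve Literature.NumberTheory.EllipticCurves Literature.NumberTheory.EllipticCurves.ModularForms
open Summit.BirchSwinnertonDyer.Rank1Residual.ManinAdditive.CuspidalKummer
open Summit.BirchSwinnertonDyer.Rank1Residual.ManinAdditive.CuspidalKummerThree

namespace Summit.BirchSwinnertonDyer.BirchSwinnertonDyer.Theorems.ManinLocalTwoThree.KummerCover

/-- `Ψ₃^{E_{W,c}}(c²(x + b₂/12)) = c⁸·Ψ₃^W(x)` at the level of `IsRoot`. [folklore] -/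
theorem isRoot_Ψ₃_shortModel_of_isRoot (W : WeierstrassCurve ℚ) (c : ℤ) {x₀ : ℚ} (hx : W.Ψ₃.IsRoot x₀) :
    (shortModel W c).Ψ₃.IsRoot ((c : ℚ) ^ 2 * (x₀ + W.b₂ / 12)) := by
  rw [isRoot_Ψ₃_shortModel_iff]
  rw [Polynomial.IsRoot, WeierstrassCurve.Ψ₃] at hx
  simp only [Polynomial.eval_add, Polynomial.eval_mul, Polynomial.eval_pow, Polynomial.eval_C, Polynomial.eval_X,
    Polynomial.eval_ofNat] at hx
  simp only [shortModel, WeierstrassCurve.c₄, WeierstrassCurve.c₆, WeierstrassCurve.b₂, WeierstrassCurve.b₄, WeierstrassCurve.b₆,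
    WeierstrassCurve.b₈] at hx ⊢
  linear_combination (c : ℚ) ^ 8 * hx

/-- **(EXISTC) — reducible `E[3]` without rational `3`-torsion yields a `K`-point of order `3` with rational abscissa, irrational ordinate and an
analytic lift** (-an g39's `ReducibleShortThreeTorsionLiftC` with `IsShortThreeTorsionC` unfolded).  Proof in the module docstring.
[cite: Cremona1997, §3.8] [cite: SilvermanAEC2009, III.4.12 and Exercise 3.7] -/
theorem exists_shortThreeTorsionC_lift (W : WeierstrassCurve ℚ) [W.IsElliptic] [W.IsGloballyMinimal] {N : ℕ} [NeZero N]
    (D : ModularParametrizationData W N) (hred : ¬ W.HasIrreducibleModPGaloisRep 3)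
    (hT : ∀ X₀ Y₀ : ℚ, ¬ IsShortThreeTorsion W D.c X₀ Y₀) :
    ∃ (X₀ : ℚ) (Y₀ u : ℂ),
      (((shortModel W D.c).map (algebraMap ℚ ℂ)).toAffine.Nonsingular (X₀ : ℂ) Y₀ ∧ (shortModel W D.c).Ψ₃.IsRoot X₀) ∧
      (∀ y : ℚ, Y₀ ≠ (y : ℂ)) ∧ u ∉ D.L.lattice ∧ 3 * u ∈ D.L.lattice ∧
      (D.c : ℂ) ^ 2 * ℘[D.L] u = (X₀ : ℂ) ∧ (D.c : ℂ) ^ 3 * ℘'[D.L] u / 2 = Y₀ := by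
  have hc0 : D.c ≠ 0 := D.maninConstant_ne_zero_holds
  have hcQ : (D.c : ℚ) ≠ 0 := Int.cast_ne_zero.mpr hc0
  have hcC : (D.c : ℂ) ≠ 0 := Int.cast_ne_zero.mpr hc0
  -- a rational root of `Ψ₃^W` and a third-period above it
  obtain ⟨x₀, hx₀⟩ := W.exists_isRoot_Ψ₃_of_not_hasIrreducibleModPGaloisRep_three hred
  set q : ℚ := x₀ + W.b₂ / 12 with hq
  have hqΨ : W.Ψ₃.eval (q - W.b₂ / 12) = 0 := by
    rw [hq, add_sub_cancel_right]; exact hx₀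
  obtain ⟨u, hu, h℘, h3u⟩ := exists_third_period_of_Ψ₃_root W D.isNeronLattice q hqΨ
  set X₀ : ℚ := (D.c : ℚ) ^ 2 * q with hX₀
  set Y₀ : ℂ := (D.c : ℂ) ^ 3 * ℘'[D.L] u / 2 with hY₀
  have hX : (D.c : ℂ) ^ 2 * ℘[D.L] u = (X₀ : ℂ) := by rw [h℘, hX₀]; push_cast; ring
  -- `Ψ₃^{E_{W,c}}(X₀) = 0`
  have hΨ : (shortModel W D.c).Ψ₃.IsRoot X₀ := by
    rw [hX₀, hq]; exact isRoot_Ψ₃_shortModel_of_isRoot W D.c hx₀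
  -- the short-model equation over `ℂ` from `℘'² = 4℘³ − g₂℘ − g₃`
  have hg₂ : D.L.g₂ = (W.c₄ : ℂ) / 12 := by
    have h := D.isNeronLattice.1; rw [WeierstrassCurve.baseChange, map_c₄] at h; simpa using h
  have hg₃ : D.L.g₃ = (W.c₆ : ℂ) / 216 := by
    have h := D.isNeronLattice.2; rw [WeierstrassCurve.baseChange, map_c₆] at h; simpa using h
  set V := (shortModel W D.c).map (algebraMap ℚ ℂ) with hV
  have ha₁ : V.a₁ = 0 := by simp [hV, shortModel]
  have ha₂ : V.a₂ = 0 := by simp [hV, shortModel]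
  have ha₃ : V.a₃ = 0 := by simp [hV, shortModel]
  have ha₄ : V.a₄ = -((D.c : ℂ) ^ 4 * (W.c₄ : ℂ) / 48) := by simp [hV, shortModel]
  have ha₆ : V.a₆ = -((D.c : ℂ) ^ 6 * (W.c₆ : ℂ) / 864) := by simp [hV, shortModel]
  have heqC : V.toAffine.Equation (X₀ : ℂ) Y₀ := by
    rw [WeierstrassCurve.Affine.equation_iff, ha₁, ha₂, ha₃, ha₄, ha₆, ← hX, hY₀]
    have hsq := D.L.derivWeierstrassP_sq u hu
    rw [hg₂, hg₃] at hsq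
    linear_combination ((D.c : ℂ) ^ 6 / 4) * hsq
  have hΔV : V.Δ ≠ 0 := by
    rw [hV, WeierstrassCurve.map_Δ, shortModel_Δ]
    simp only [eq_ratCast, ne_eq, Rat.cast_eq_zero]
    exact mul_ne_zero (pow_ne_zero _ hcQ) W.isUnit_Δ.ne_zero
  have hnsC : V.toAffine.Nonsingular (X₀ : ℂ) Y₀ := (V.toAffine.equation_iff_nonsingular_of_Δ_ne_zero hΔV).mp heqC
  refine ⟨X₀, Y₀, u, ⟨hnsC, hΨ⟩, ?_, hu, h3u, hX, rfl⟩
  -- `Y₀ ∉ ℚ`: a rational ordinate would give a rational point of order `3`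
  intro y hy
  apply hT X₀ y
  refine ⟨?_, hΨ⟩
  have hΔ : (shortModel W D.c).Δ ≠ 0 := by
    rw [shortModel_Δ]; exact mul_ne_zero (pow_ne_zero _ hcQ) W.isUnit_Δ.ne_zero
  refine ((shortModel W D.c).toAffine.equation_iff_nonsingular_of_Δ_ne_zero hΔ).mp ?_
  rw [WeierstrassCurve.Affine.equation_iff]
  have h1 : (shortModel W D.c).a₁ = 0 := rfl
  have h2 : (shortModel W D.c).a₂ = 0 := rfl
  have h3 : (shortModel W D.c).a₃ = 0 := rfl
  have h4 : (shortModel W D.c).a₄ = -((D.c : ℚ) ^ 4 * W.c₄ / 48) := rfl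
  have h6 : (shortModel W D.c).a₆ = -((D.c : ℚ) ^ 6 * W.c₆ / 864) := rfl
  rw [h1, h2, h3, h4, h6]
  have heqC' := (WeierstrassCurve.Affine.equation_iff _ _).mp heqC
  rw [ha₁, ha₂, ha₃, ha₄, ha₆, hy] at heqC'
  have hcast : ((y ^ 2 + 0 * X₀ * y + 0 * y : ℚ) : ℂ) =
      ((X₀ ^ 3 + 0 * X₀ ^ 2 + -((D.c : ℚ) ^ 4 * W.c₄ / 48) * X₀ + -((D.c : ℚ) ^ 6 * W.c₆ / 864) : ℚ) : ℂ) := by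
    push_cast
    linear_combination heqC'
  exact_mod_cast hcast

end Summit.BirchSwinnertonDyer.BirchSwinnertonDyer.Theorems.ManinLocalTwoThree.KummerCover

end
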